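import Literature.AnabelianGeometry.SemiGraphs.FundamentalGroup
import Literature.AnabelianGeometry.SemiGraphs.GraphOfAnabelioids

/-!
# `Cat(𝔾)` and generalized morphisms of semi-graphs of anabelioids ([SemiAnbd] §2, Def. 2.11, p. 32)

Mochizuki, *Semi-graphs of anabelioids*, Publ. RIMS **42** (2006) 221–322, §2, author's manuscript
p. 32 [cite: MochizukiSemiAnbd2006, Def. 2.11 p.32]:

* `Cat(𝔾)` (p. 32) is `SemiGraph.Cat` of `FundamentalGroup.lean` (path category of the quiver with
  one arrow `e → v` per abutting branch);
* Definition 2.11: a *generalized morphism* `Φ : 𝒢 → ℋ` = (a) a functor `Cat(Φ) : Cat(𝔾) → Cat(ℍ)`,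
  (b) for every object `c ↦ d` a morphism of anabelioids `Φ_c : 𝒢_c → ℋ_d`, (c) for every arrow
  `φ : c → c'` mapped to `ψ : d → d'` an isomorphism `Φ_φ : ψ_* ∘ Φ_c ⥲ Φ_{c'} ∘ φ_*`, the identity
  when `φ` is an identity;
* Remark 2.11.1: every morphism is a generalized morphism; a generalized morphism induces
  `B(𝒢) → B(ℋ)` — NAMED FACTS (existence statements).

Rendering.  The constituent at a component, `𝒢.constituent c`, and the functor
`(φ_*)^* : 𝒢_{c'} ⥤ 𝒢_c` of a morphism (`b^*` for a branch, the identity for an identity) give (b),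
(c); the condition "`Φ_φ` is the identity whenever `φ` is an identity" is stated through `eqToHom`,
since `Cat(Φ)` maps identities to identities only propositionally.
-/

namespace Literature.AnabelianGeometry.SemiGraphs

open CategoryTheory
open Literature.AnabelianGeometry.Anabelioids

universe v₁ u₁ u

namespace SemiGraphOfAnabelioids

variable (𝒢 : SemiGraphOfAnabelioids.{v₁, u₁, u})

/-- The constituent anabelioid `𝒢_c` at a component `c` of `𝔾` (p. 32: "for every object `c` of
`Cat(𝔾)`, we have an anabelioid `𝒢_c`"). [cite: MochizukiSemiAnbd2006, Def. 2.11 p.32] -/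
def constituent : 𝒢.graph.CatCarrier → Type u₁
  | Sum.inl v => 𝒢.V v
  | Sum.inr e => 𝒢.E e

/-- Category structure of the constituent at a component. [cite: MochizukiSemiAnbd2006, Def. 2.11 p.32] -/
instance instCategoryConstituent : ∀ c : 𝒢.graph.CatCarrier, Category.{v₁} (𝒢.constituent c)
  | Sum.inl v => inferInstanceAs (Category (𝒢.V v))
  | Sum.inr e => inferInstanceAs (Category (𝒢.E e))

/-- The constituents are connected anabelioids. [cite: MochizukiSemiAnbd2006, Def. 2.11 p.32] -/
instance instGaloisConstituent : ∀ c : 𝒢.graph.CatCarrier, GaloisCategory (𝒢.constituent c)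
  | Sum.inl v => inferInstanceAs (GaloisCategory (𝒢.V v))
  | Sum.inr e => inferInstanceAs (GaloisCategory (𝒢.E e))

variable {𝒢}

/-- The pull-back functor `(b_*)^* : 𝒢_v ⥤ 𝒢_e` of a generating arrow `b : e → v` (p. 32: "for every
morphism `b : e → v` of `Cat(𝔾)`, we have a morphism of anabelioids `b_* : 𝒢_e → 𝒢_v`"), transported
along `edgeOf b = e`. [cite: MochizukiSemiAnbd2006, Def. 2.11 p.32] -/
noncomputable def branchFunctor {e : 𝒢.graph.Edge} {v : 𝒢.graph.Vertex}
    (b : {b : 𝒢.graph.Branch // 𝒢.graph.edgeOf b = e ∧ 𝒢.graph.abuts b = some v}) :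
    𝒢.V v ⥤ 𝒢.E e :=
  b.2.1 ▸ (𝒢.pull b.1 v b.2.2).pullback

/-- The pull-back functor of a generating arrow of `Cat(𝔾)`, by cases on its source and target
(only `e → v` arrows exist). [cite: MochizukiSemiAnbd2006, Def. 2.11 p.32] -/
noncomputable def arrowMap : ∀ {c c' : 𝒢.graph.CatCarrier}, (c ⟶ c') →
    (𝒢.constituent c' ⥤ 𝒢.constituent c)
  | Sum.inr _, Sum.inl _, b => branchFunctor b
  | Sum.inl _, Sum.inl _, f => PEmpty.elim f
  | Sum.inl _, Sum.inr _, f => PEmpty.elim f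
  | Sum.inr _, Sum.inr _, f => PEmpty.elim f

/-- The pull-back functor `(φ_*)^* : 𝒢_{c'} ⥤ 𝒢_c` of a morphism `φ : c → c'` of `Cat(𝔾)` (a path of
length `≤ 1`): the identity for identities, `b^*` for a branch.
[cite: MochizukiSemiAnbd2006, Def. 2.11 p.32] -/
noncomputable def atMap {c : 𝒢.graph.CatCarrier} :
    ∀ {c' : 𝒢.graph.CatCarrier}, Quiver.Path c c' → (𝒢.constituent c' ⥤ 𝒢.constituent c)
  | _, Quiver.Path.nil => 𝟭 _
  | _, Quiver.Path.cons p a => arrowMap a ⋙ atMap p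

/-- A *generalized morphism of semi-graphs of anabelioids* `Φ : 𝒢 → ℋ` ([SemiAnbd] Def. 2.11): (a) a
functor `Cat(Φ) : Cat(𝔾) → Cat(ℍ)`; (b) morphisms of anabelioids `Φ_c : 𝒢_c → ℋ_{Cat(Φ)(c)}`; (c) for
every arrow `φ : c → c'` with image `ψ`, an isomorphism `Φ_φ : ψ_* ∘ Φ_c ⥲ Φ_{c'} ∘ φ_*` (as pull-back
functors `ℋ_{d'} ⥤ 𝒢_c`: `Φ_c^* ∘ ψ^* ≅ φ^* ∘ Φ_{c'}^*`), equal to the identity (up to the transport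
`Cat(Φ)(𝟙) = 𝟙`) when `φ` is an identity. [cite: MochizukiSemiAnbd2006, Def. 2.11 p.32] -/
structure GeneralizedHom (𝒢 ℋ : SemiGraphOfAnabelioids.{v₁, u₁, u}) where
  /-- (a) the functor `Cat(Φ)` -/
  functor : 𝒢.graph.Cat ⥤ ℋ.graph.Cat
  /-- (b) the morphisms of anabelioids `Φ_c : 𝒢_c → ℋ_d` -/
  φ : ∀ c : 𝒢.graph.Cat, Anabelioids.Hom (𝒢.constituent c) (ℋ.constituent (functor.obj c))
  /-- (c) the isomorphisms `Φ_φ` -/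
  iso : ∀ {c c' : 𝒢.graph.Cat} (f : c ⟶ c'),
    atMap (functor.map f) ⋙ (φ c).pullback ≅ (φ c').pullback ⋙ atMap f
  /-- (c) `Φ_φ` is the identity whenever `φ` is an identity morphism -/
  iso_id : ∀ c : 𝒢.graph.Cat, (iso (𝟙 c)).hom =
    eqToHom (by rw [functor.map_id]; rfl)

/-- NAMED FACT, [SemiAnbd] Remark 2.11.1, first sentence: "every [non-generalized] morphism of
semi-graphs of anabelioids determines a generalized morphism of semi-graphs of anabelioids" (with
the same underlying maps on components and the same `Φ_v`, `Φ_e`).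
[cite: MochizukiSemiAnbd2006, Rem. 2.11.1 p.32] -/
def remark_2_11_1_ofHom : Prop :=
  ∀ (𝒢 ℋ : SemiGraphOfAnabelioids.{v₁, u₁, u}) (φ : Hom 𝒢 ℋ), ∃ Φ : GeneralizedHom 𝒢 ℋ,
    (∀ v, Φ.functor.obj (Sum.inl v) = Sum.inl (φ.base.vertexMap v)) ∧
      ∀ e, Φ.functor.obj (Sum.inr e) = Sum.inr (φ.base.edgeMap e)

/-- NAMED FACT, [SemiAnbd] Remark 2.11.1, second sentence: "every generalized morphism of semi-graphs of
connected anabelioids `Φ : 𝒢 → ℋ` determines, in a natural fashion, a morphism `B(𝒢) → B(ℋ)` between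
the associated anabelioids" — an exact functor `B(ℋ) ⥤ B(𝒢)`.
[cite: MochizukiSemiAnbd2006, Rem. 2.11.1 p.32] -/
def remark_2_11_1_toB : Prop :=
  ∀ (𝒢 ℋ : SemiGraphOfAnabelioids.{v₁, u₁, u}) (_ : GeneralizedHom 𝒢 ℋ),
    Nonempty (Anabelioids.Hom 𝒢.BObj ℋ.BObj)

end SemiGraphOfAnabelioids

end Literature.AnabelianGeometry.SemiGraphs
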